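import Summits.AtomisticToContinuum.HydrodynamicLimit.Theorems.StiffCollisionalRelaxationAprioriBoundsFibreDefsR4
import Summits.AtomisticToContinuum.HydrodynamicLimit.Theorems.StiffCollisionalRelaxationAprioriBoundsEquilibriumStatics
import HarnessLib

/-!
# Chebyshev at each level: the in-probability profile of the time-integrated tail occupations
(stub `stub_occupationInProb_of_variance` of the line `meso-chebyshev-window` for the crux `AprioriBounds`,
stmt-AtomisticToContinuum-14827; = stub 4 of the registered alternative line `Lines/tail_occupation_variance.lean`)

For `0 < σ ≤ 1/2` (so that the local Gibbs laws `P_N` are probability measures), nice profiles, `t > 0` and any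
family of hard-sphere flows `Φ`, write `occ_K(z) := ∫₀ᵗ frac_K(Φ_s z) ds ∈ [0, t]` for the time-integrated
one-particle tail occupation at level `K` (`frac_K ∈ [0, 1]` the empirical mass of `{K ≤ |v|²}`).  If
`Var_{P_N} occ_K → 0` for every `K` and the far tails hold in the mean (`FarTailAllAt`:
`E_{P_N} occ_K ≤ t·A·e^{−K/(2Θ)}` eventually in `N`, all `K`), then with the SAME `Θ` and `A' := max A 0`,
`P_N{ t·A'·e^{−K/(2Θ)} + η < occ_K } → 0` for every `K` and every `η > 0`.

Proof: `occ_K` is `P_N`-a.e. measurable (joint a.e. measurability of observables along the flow,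
`AdiabatCeiling.aemeasurable_comp_flow_prod`, then Tonelli measurability) and bounded by `t`, hence in `L²`;
`E occ_K = (E ∫⁻ …).toReal ≤ t·A'·e^{−K/(2Θ)}` for `N ≥ N₀` (`integral_toReal`); the bad event is contained in
`{η ≤ |occ_K − E occ_K|}`, and Chebyshev (`ProbabilityTheory.meas_ge_le_variance_div_sq`) bounds its probability
by `Var occ_K / η² → 0`.

No new definitions, no named facts; axioms `propext`, `Classical.choice`, `Quot.sound`.
-/

noncomputable section

open MeasureTheory ProbabilityTheory Filter Set Topology
open scoped ENNReal

namespace Summit.AtomisticToContinuum.HydrodynamicLimit.Theorems.MesoChebyshevWindow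

open Literature.MathematicalPhysics.KineticTheory Literature.Analysis.FluidPDE
open Summit.AtomisticToContinuum.HydrodynamicLimit.Theorems.AprioriBoundsNegative (PartOneAt PartTwoAt)
open Summit.AtomisticToContinuum.HydrodynamicLimit.Theorems.VisitLedgerUpscattering (Cfg Flow Flows NiceProfiles)
open Summit.AtomisticToContinuum.HydrodynamicLimit.Theorems.FibreDeficitTransfer

/-- **Chebyshev squeeze along a sequence of probability spaces.**  If `X_N ∈ L²(P_N)` has mean `≤ B`
for `N ≥ N₀` and `Var_{P_N} X_N → 0`, then `P_N{B + η < X_N} → 0` for every `η > 0`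
(`{B + η < X_N} ⊆ {η ≤ |X_N − E X_N|}` and `ProbabilityTheory.meas_ge_le_variance_div_sq`). -/
theorem tendsto_measure_gt_of_variance {Ω : ℕ → Type*} [∀ N, MeasurableSpace (Ω N)]
    {P : ∀ N, Measure (Ω N)} (hP : ∀ N, IsProbabilityMeasure (P N))
    {X : ∀ N, Ω N → ℝ} (hX : ∀ N, MemLp (X N) 2 (P N)) {B : ℝ} {N₀ : ℕ}
    (hmean : ∀ N, N₀ ≤ N → ∫ ω, X N ω ∂P N ≤ B)
    (hvar : Tendsto (fun N => variance (X N) (P N)) atTop (𝓝 0)) {η : ℝ} (hη : 0 < η) :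
    Tendsto (fun N => P N {ω | B + η < X N ω}) atTop (𝓝 0) := by
  have hlim : Tendsto (fun N => ENNReal.ofReal (variance (X N) (P N) / η ^ 2)) atTop (𝓝 0) := by
    have h := ENNReal.tendsto_ofReal (hvar.div_const (η ^ 2))
    rwa [zero_div, ENNReal.ofReal_zero] at h
  refine tendsto_of_tendsto_of_tendsto_of_le_of_le' tendsto_const_nhds hlim
    (Eventually.of_forall fun _ => zero_le) (eventually_atTop.2 ⟨N₀, fun N hNN => ?_⟩)
  haveI := hP N
  have hm := hmean N hNN
  calc P N {ω | B + η < X N ω} ≤ P N {ω | η ≤ |X N ω - ∫ ω', X N ω' ∂P N|} := by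
        refine measure_mono fun ω hω => ?_
        simp only [Set.mem_setOf_eq] at hω ⊢
        exact le_abs.2 (Or.inl (by linarith))
    _ ≤ ENNReal.ofReal (variance (X N) (P N) / η ^ 2) := meas_ge_le_variance_div_sq (hX N) hη

/-- **The time-integrated tail occupation is square integrable and its mean is the lower integral.**  Under
the local Gibbs law of nice profiles at `σ ≤ 1/2` (a probability measure carried by the good set of the flow),
`occ_K(z) = (∫⁻_{[0,t]} ofReal (frac_K(Φ_s z)) ds).toReal` is a.e. measurable with values in `[0, t]`, hence
`MemLp 2`, and `∫ occ_K dP = (∫⁻ ∫⁻_{[0,t]} ofReal (frac_K(Φ_s z)) ds dP).toReal`. -/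
theorem occupation_memLp_and_integral_eq {σ : ℝ} {a₀ θ₀ : T3 → ℝ} {u₀ : T3 → V3}
    (hnp : NiceProfiles a₀ θ₀ u₀) (hσ2 : σ ≤ 1 / 2) {t : ℝ} (ht : 0 < t) (N : ℕ) (Φ : Flow σ N) (K : ℝ) :
    MemLp (fun z => (∫⁻ s in Icc 0 t, ENNReal.ofReal (frac K (Φ.flow s z))).toReal) 2
        (localGibbsLaw σ a₀ u₀ θ₀ N Φ) ∧
      ∫ z, (∫⁻ s in Icc 0 t, ENNReal.ofReal (frac K (Φ.flow s z))).toReal ∂(localGibbsLaw σ a₀ u₀ θ₀ N Φ) =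
        (∫⁻ z, (∫⁻ s in Icc 0 t, ENNReal.ofReal (frac K (Φ.flow s z)))
          ∂(localGibbsLaw σ a₀ u₀ θ₀ N Φ)).toReal := by
  obtain ⟨ha, hθ, hu, ha0, hθ0⟩ := hnp
  haveI := isProbabilityMeasure_localGibbsLaw ha hθ hu ha0 hθ0 hσ2 N Φ
  have hgood : localGibbsLaw σ a₀ u₀ θ₀ N Φ Φ.goodᶜ = 0 := by
    rw [localGibbsLaw_eq]
    exact (localGibbsMeasure_absolutelyContinuous σ _ _ _ N Φ) Φ.measure_compl_good
  have hprod := AdiabatCeiling.aemeasurable_comp_flow_prod Φ (measurable_frac K).ennreal_ofReal hgood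
    (volume.restrict (Icc 0 t))
  have hOm : AEMeasurable (fun z => ∫⁻ s in Icc 0 t, ENNReal.ofReal (frac K (Φ.flow s z)))
      (localGibbsLaw σ a₀ u₀ θ₀ N Φ) := hprod.lintegral_prod_right'
  have hbound : ∀ z, (∫⁻ s in Icc 0 t, ENNReal.ofReal (frac K (Φ.flow s z))) ≤ ENNReal.ofReal t := by
    intro z
    calc (∫⁻ s in Icc 0 t, ENNReal.ofReal (frac K (Φ.flow s z)))
        ≤ ∫⁻ _ in Icc 0 t, (1 : ℝ≥0∞) :=
          lintegral_mono fun s => ENNReal.ofReal_le_one.2 (frac_mem_Icc K _).2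
      _ = ENNReal.ofReal t := by rw [setLIntegral_one, Real.volume_Icc, sub_zero]
  refine ⟨memLp_of_bounded (a := 0) (b := t)
    (ae_of_all _ fun z => ⟨ENNReal.toReal_nonneg, ENNReal.toReal_le_of_le_ofReal ht.le (hbound z)⟩)
    hOm.ennreal_toReal.aestronglyMeasurable 2, ?_⟩
  exact integral_toReal hOm (ae_of_all _ fun z => (hbound z).trans_lt ENNReal.ofReal_lt_top)

/-- STUB `occupationInProb_of_variance` of the line `meso-chebyshev-window` (= stub 4 of
`Lines/tail_occupation_variance.lean`; PROVED — Chebyshev at each level).  For `0 < σ ≤ 1/2` (so that the local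
Gibbs laws are probability measures, `isProbabilityMeasure_localGibbsLaw`), nice profiles, `t > 0`, any flow family:
vanishing variances of the time-integrated occupations `occ_K = ∫₀ᵗ frac_K(Φ_s ·) ds` at every level and far tails in
the mean (`FarTailAllAt`, constants `Θ, A`) give the IN-PROBABILITY GAUSSIAN PROFILE OF THE OCCUPATIONS with the
constants `Θ` and `max A 0`: `P_N{ t·(max A 0)·e^{−K/(2Θ)} + η < occ_K } → 0` for all `K` and all `η > 0`. -/
theorem stub_occupationInProb_of_variance :
    ∀ (σ : ℝ) (a₀ θ₀ : T3 → ℝ) (u₀ : T3 → V3)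
      (Φ : (N : ℕ) → HardSphereFlow (Torus.geometry (Fin 3)) (hsDiameter σ N) (N + 1)) (t : ℝ),
      0 < σ → σ ≤ 1 / 2 → NiceProfiles a₀ θ₀ u₀ → 0 < t →
      (∀ K : ℝ, Tendsto (fun N : ℕ => variance
          (fun z => (∫⁻ s in Icc 0 t, ENNReal.ofReal (frac K ((Φ N).flow s z))).toReal)
          (localGibbsLaw σ a₀ u₀ θ₀ N (Φ N))) atTop (𝓝 0)) →
      FarTailAllAt σ a₀ θ₀ u₀ Φ t →
        ∃ Θ A : ℝ, 0 < Θ ∧ ∀ K : ℝ, ∀ η : ℝ, 0 < η →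
          Tendsto (fun N : ℕ => localGibbsLaw σ a₀ u₀ θ₀ N (Φ N)
            {z | t * A * Real.exp (-(K / (2 * Θ))) + η <
              (∫⁻ s in Icc 0 t, ENNReal.ofReal (frac K ((Φ N).flow s z))).toReal}) atTop (𝓝 0) := by
  intro σ a₀ θ₀ u₀ Φ t _hσ hσ2 hnp ht hvar hfar
  obtain ⟨Θ, A, hΘ, N₀, hN⟩ := hfar
  refine ⟨Θ, max A 0, hΘ, fun K η hη => ?_⟩
  obtain ⟨ha, hθ, hu, ha0, hθ0⟩ := hnp
  refine tendsto_measure_gt_of_variance (P := fun N => localGibbsLaw σ a₀ u₀ θ₀ N (Φ N))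
    (fun N => isProbabilityMeasure_localGibbsLaw ha hθ hu ha0 hθ0 hσ2 N (Φ N))
    (X := fun N z => (∫⁻ s in Icc 0 t, ENNReal.ofReal (frac K ((Φ N).flow s z))).toReal)
    (fun N => (occupation_memLp_and_integral_eq ⟨ha, hθ, hu, ha0, hθ0⟩ hσ2 ht N (Φ N) K).1) (N₀ := N₀)
    (B := t * max A 0 * Real.exp (-(K / (2 * Θ)))) (fun N hNN => ?_) (hvar K) hη
  have hB0 : 0 ≤ t * max A 0 * Real.exp (-(K / (2 * Θ))) :=
    mul_nonneg (mul_nonneg ht.le (le_max_right _ _)) (Real.exp_pos _).le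
  have hAB : t * A * Real.exp (-(K / (2 * Θ))) ≤ t * max A 0 * Real.exp (-(K / (2 * Θ))) :=
    mul_le_mul_of_nonneg_right (mul_le_mul_of_nonneg_left (le_max_left A 0) ht.le) (Real.exp_pos _).le
  rw [(occupation_memLp_and_integral_eq ⟨ha, hθ, hu, ha0, hθ0⟩ hσ2 ht N (Φ N) K).2]
  exact ENNReal.toReal_le_of_le_ofReal hB0 ((hN N hNN K).trans (ENNReal.ofReal_le_ofReal hAB))

end Summit.AtomisticToContinuum.HydrodynamicLimit.Theorems.MesoChebyshevWindow

end
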